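/-
Copyright (c) 2026 the pub-hodgecm-mathlib formalisation cell (harness21).  Prover seat hodgecm-mathlib-K2E3-p21 (g4), Track B «K2-LIT» ∕ h413
(`stmt-HodgeConjecture-24833`), line `K2_E3_EllipticInputs`, (SC-an) road «FC» (line lead K2E3-p14 (g4), RULINGS #15 ∕ MAP v5 step (v), RULINGS #18
(R18-3)), brick (FC-D); head frozen by K2E3-p20 (g4) 2026-09-04T03:50:25Z, consumed by (FC-5) `K2E3DiagonalCollisionMeasure` (K2E2-p13 (g3)).  2026-09-04.
-/
import Literature.NumberTheory.Automorphic.LocalFieldHaarBalls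
import Mathlib.Analysis.SpecialFunctions.Pow.NNReal
import Mathlib.Analysis.SpecialFunctions.Log.Basic
import HarnessLib

/-!
# Crux `H413` — K2-LIT E3, (SC-an) road «FC» (finite conjugation measure), brick (FC-D): THE DIGIT-COUNT FIBRE BOUNDS ON THE UNIT GROUP
# `λ×{a ∈ 𝒪ˣ : |a·x − y| ≤ r} ≤ C r^κ λ×(𝒪ˣ)` and `λ×{a ∈ 𝒪ˣ : |a·σ(a)·x − y| ≤ r} ≤ C r^κ λ×(𝒪ˣ)` (`|x| = 1`, `r ≤ 1`)

Cell `hodgecm-mathlib`, Track B, line `K2_E3_EllipticInputs`, socket U12 :255 (SC-an) via road «FC» of K2E3-p14 (g4) (RULINGS #15 (R15-1) step (v): the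
ADDITIVE event `|a x − y| ≤ r` and the NORM event `|a σ(a) x − y| ≤ r` on `𝒪_K^×`, which (FC-5) sums over the diagonal collision clauses of `t_a · g`,
`t_a = diag(a, 1, σ(a)⁻¹)`).  HEAD = K2E3-p20 (g4)'s frozen bytes (2026-09-04T03:50:25Z) VERBATIM.  THEOREMS ONLY; count-neutral helper
(`--supports stmt-HodgeConjecture-24833 --as helper`).

THE MATHEMATICS — ONE INDEX ARGUMENT FOR BOTH EVENTS, UNIFORM IN `σ` (`σ = id` included; no filtration-index formula, no fixed field, no Hensel).  `K` a
non-archimedean local field of characteristic `0`, `|·| = normAbs K`, residue characteristic `p`, `σ : K →+* K` isometric, `μ'` left-invariant on `Kˣ`,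
`𝒪ˣ = {v = 1}`.  For `φ : Kˣ → K` multiplicative with `|φ| = 1` on `𝒪ˣ` (here `φ(a) = a` and `φ(a) = a·σ(a)`) put `E_φ(c, r) := {a ∈ 𝒪ˣ : |φ(a) − c| ≤ r}`;
as `|x| = 1`, `|a x − y| = |a − y x⁻¹|`, so both events of the head have this form.  (§1, §3) If `u_1, …, u_B ∈ 𝒪ˣ` have `|φ(u_i) − φ(u_j)| > r` for `i ≠ j`,
the translates `u_i • E_φ(c, r) ⊆ 𝒪ˣ` are pairwise disjoint (`u_i a = u_j a'` forces `|φ u_i − φ u_j| = |φ a − φ a'| ≤ r`), so **`B · μ'(E_φ) ≤ μ'(𝒪ˣ)`**.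
(§3) The TEST UNITS `u_m := 1 + p² m`, `m < p^k`, are fixed by `σ` (rational integers), `φ(u_m) = u_m` resp. `u_m²`, and `|u_m^e − u_{m'}^e| ≥ |2|·|p|^{k+1}`
(`e = 1, 2`: the difference is `p²(m − m')` resp. `p²(m − m')(2 + p²(m + m'))`, `|2 + p²(m+m')| = |2|`, `|m − m'| ≥ |p|^{k−1}`).  (§4) Hence
**`p^k · μ'(E) ≤ μ'(𝒪ˣ)` for `r < |2|·|p|^{k+1}`**; (§5) with `k` maximal and `κ := log p ∕ log |p|⁻¹` (`|p|^κ = p⁻¹`, i.e. `κ = 1∕[K:ℚ_p]`) this is the head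
with `C := p² (|2||p|)^{−κ}` (`r = 0` gives measure `0`; `r ≥ |2||p|` is clamped by `μ'(E) ≤ μ'(𝒪ˣ)`).  §2: an isometric `σ` is continuous, so the events are Borel.

HONEST LABEL: HC_CM is proved only modulo the 7 printed citations (2 remaining named inputs: hLiu418 = stmt-HodgeConjecture-24832, h413 =
stmt-HodgeConjecture-24833) until rung 0 closes; elementary, closes no organ by itself ((SC-an) is NOT ★ until (FC-5)∕(FC-6)∕(FC-8)∕(FC-9) land too).

## References
* [Serre1979] J.-P. Serre, *Local Fields*, GTM 67 (1979), Ch. IV §2 (the filtration `U^{(n)}` of the unit group and its indices), Ch. II §3.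
* [Folland1995] G. B. Folland, *A Course in Abstract Harmonic Analysis* (1995), §2.2 (left invariance of Haar measure).
-/

set_option autoImplicit false
-- the mandated namespace repeats `HodgeConjecture.HodgeConjecture`, as in every `Theorems/*.lean` of this sub-problem
set_option linter.dupNamespace false

noncomputable section

open MeasureTheory MeasureTheory.Measure Set Function
open scoped NNReal ENNReal Pointwise Valued
open ValuativeRel
open Literature.NumberTheory.GaloisRepresentations Literature.NumberTheory.GaloisRepresentations.IsNonarchimedeanLocalField
open Literature.NumberTheory.Automorphic Literature.NumberTheory.Automorphic.LocalFieldHaar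

namespace Summit.HodgeConjecture.HodgeConjecture.Cruxes.H413.K2E3UnitsDigitFibre

/-! ## §1  Disjoint translates: `B · μ(E) ≤ μ(S)` -/

/-- **Disjoint translates bound.**  If the left translates `u i • E` (`i ∈ s`) of a measurable set `E` are pairwise disjoint and all contained in `S`, then
`|s| · μ(E) ≤ μ(S)` for every left-invariant measure `μ`. [cite: Folland1995, §2.2] -/
theorem card_mul_measure_le_of_pairwiseDisjoint_smul {G : Type*} [Group G] [MeasurableSpace G] [MeasurableMul G] (μ : Measure G)
    [μ.IsMulLeftInvariant] {ι : Type*} (s : Finset ι) (u : ι → G) {E S : Set G} (hE : MeasurableSet E)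
    (hdisj : (s : Set ι).PairwiseDisjoint fun i => u i • E) (hsub : ∀ i ∈ s, u i • E ⊆ S) : (s.card : ℝ≥0∞) * μ E ≤ μ S := by
  calc (s.card : ℝ≥0∞) * μ E = ∑ i ∈ s, μ (u i • E) := by simp only [measure_smul, Finset.sum_const, nsmul_eq_mul]
    _ = μ (⋃ i ∈ s, u i • E) := (measure_biUnion_finset hdisj fun i _ => hE.const_smul (u i)).symm
    _ ≤ μ S := measure_mono (Set.iUnion₂_subset hsub)

variable {K : Type*} [Field K] [ValuativeRel K] [TopologicalSpace K] [IsNonarchimedeanLocalField K]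

/-! ## §2  An isometric ring endomorphism is continuous; the events `{a ∈ 𝒪ˣ : |f a| ≤ r}` are Borel -/

/-- **An absolute-value-preserving ring endomorphism of a non-archimedean local field is continuous**: it preserves the valuation, hence maps the basic
neighbourhoods `{v < γ}` of `0` into themselves. [cite: Serre1979, Ch. II §3] -/
theorem continuous_of_normAbs_eq (σ : K →+* K) (hσn : ∀ x, normAbs K (σ x) = normAbs K x) : Continuous σ := by
  have hv : ∀ x, valuation K (σ x) = valuation K x := fun x =>
    le_antisymm (normAbs_le_normAbs_iff.1 (hσn x).le) (normAbs_le_normAbs_iff.1 (hσn x).ge)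
  apply continuous_of_continuousAt_zero σ
  rw [ContinuousAt, map_zero]
  exact ((IsValuativeTopology.hasBasis_nhds_zero K).tendsto_iff (IsValuativeTopology.hasBasis_nhds_zero K)).2 fun γ _ =>
    ⟨γ, trivial, fun x hx => by rw [Set.mem_setOf_eq] at hx ⊢; rwa [hv]⟩

/-- The event `{a ∈ 𝒪ˣ : |f(a)| ≤ r}` is Borel for a continuous `f : Kˣ → K`. [folklore] -/
theorem measurableSet_sphere_inter_normAbs_le [MeasurableSpace Kˣ] [BorelSpace Kˣ] {f : Kˣ → K} (hf : Continuous f) (r : ℝ≥0) :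
    MeasurableSet {a : Kˣ | valuation K (a : K) = 1 ∧ normAbs K (f a) ≤ r} :=
  (isOpen_units_valuation_eq_one (F := K)).measurableSet.inter (isClosed_le (continuous_normAbs.comp hf) continuous_const).measurableSet

/-! ## §3  The algebraic core: disjoint translates of `E_φ(c, r)`, and the test units `1 + p² m` -/

/-- `|z x − y| = |z − y x⁻¹|` for `|x| = 1`: the events of the head are events `|φ(a) − c| ≤ r`. [folklore] -/
theorem normAbs_mul_sub_eq_of_normAbs_eq_one {x : K} (hx : normAbs K x = 1) (z y : K) :
    normAbs K (z * x - y) = normAbs K (z - y * x⁻¹) := by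
  have hx0 : x ≠ 0 := fun h => by rw [h, map_zero] at hx; exact zero_ne_one hx
  have h : z * x - y = (z - y * x⁻¹) * x := by field_simp
  rw [h, map_mul, hx, mul_one]

/-- **Disjointness of two translates of `E_φ(c, r)`.**  For `φ` multiplicative with `|φ| = 1` on `𝒪ˣ`, `u ∈ 𝒪ˣ` and `u'` with `|φ(u) − φ(u')| > r`, the translates
`u • E_φ(c, r)` and `u' • E_φ(c, r)` are disjoint: `u a = u' a'` gives `φ(u)(φ a − φ a') = (φ u' − φ u) φ a'`, so `|φ u − φ u'| = |φ a − φ a'| ≤ r`. [folklore] -/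
theorem disjoint_smul_event (φ : Kˣ → K) (hφ : ∀ a b, φ (a * b) = φ a * φ b) (hφ1 : ∀ a : Kˣ, valuation K (a : K) = 1 → normAbs K (φ a) = 1)
    (c : K) (r : ℝ≥0) {u u' : Kˣ} (hu : valuation K (u : K) = 1) (hsep : r < normAbs K (φ u - φ u')) :
    Disjoint (u • {a : Kˣ | valuation K (a : K) = 1 ∧ normAbs K (φ a - c) ≤ r})
      (u' • {a : Kˣ | valuation K (a : K) = 1 ∧ normAbs K (φ a - c) ≤ r}) := by
  rw [Set.disjoint_left]
  rintro _ ⟨a, ⟨ha1, hac⟩, rfl⟩ ⟨a', ⟨ha'1, ha'c⟩, h⟩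
  simp only [smul_eq_mul] at h
  have hφeq : φ u' * φ a' = φ u * φ a := by rw [← hφ, ← hφ, h]
  have haa' : normAbs K (φ a - φ a') ≤ r := by
    have e : φ a - φ a' = (φ a - c) + -(φ a' - c) := by ring
    rw [e]
    exact (normAbs_add_le_max _ _).trans (max_le hac (by rwa [normAbs_neg]))
  have key : φ u * (φ a - φ a') = (φ u' - φ u) * φ a' := by rw [mul_sub, sub_mul, hφeq]
  have hn := congrArg (normAbs K) key
  rw [map_mul, map_mul, hφ1 u hu, hφ1 a' ha'1, one_mul, mul_one] at hn
  have : normAbs K (φ u - φ u') ≤ r := by rw [← normAbs_neg, neg_sub, ← hn]; exact haa'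
  exact absurd hsep (not_lt.2 this)

/-- **THE COUNT.**  If `u i ∈ 𝒪ˣ` (`i ∈ s`) have pairwise `|φ(u i) − φ(u j)| > r`, then `|s| · μ'(E_φ(c, r)) ≤ μ'(𝒪ˣ)` for every left-invariant `μ'` on `Kˣ`
(the translates `u i • E_φ(c, r)` are pairwise disjoint subsets of `𝒪ˣ`). [cite: Folland1995, §2.2] -/
theorem card_mul_measure_event_le [MeasurableSpace Kˣ] [BorelSpace Kˣ] (μ' : Measure Kˣ) [μ'.IsMulLeftInvariant] (φ : Kˣ → K)
    (hφ : ∀ a b, φ (a * b) = φ a * φ b) (hφ1 : ∀ a : Kˣ, valuation K (a : K) = 1 → normAbs K (φ a) = 1) (c : K) (r : ℝ≥0)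
    (hEm : MeasurableSet {a : Kˣ | valuation K (a : K) = 1 ∧ normAbs K (φ a - c) ≤ r})
    {ι : Type*} (s : Finset ι) (u : ι → Kˣ) (hu : ∀ i ∈ s, valuation K (u i : K) = 1)
    (hsep : ∀ i ∈ s, ∀ j ∈ s, i ≠ j → r < normAbs K (φ (u i) - φ (u j))) :
    (s.card : ℝ≥0∞) * μ' {a : Kˣ | valuation K (a : K) = 1 ∧ normAbs K (φ a - c) ≤ r} ≤ μ' {a : Kˣ | valuation K (a : K) = 1} := by
  refine card_mul_measure_le_of_pairwiseDisjoint_smul μ' s u hEm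
    (fun i hi j hj hij => disjoint_smul_event φ hφ hφ1 c r (hu i hi) (hsep i hi j hj hij)) fun i hi => ?_
  rintro _ ⟨a, ha, rfl⟩
  show valuation K ((u i * a : Kˣ) : K) = 1
  rw [Units.val_mul, map_mul, hu i hi, ha.1, one_mul]

/-- The residue characteristic is a prime. [cite: Serre1979, Ch. II §3] -/
theorem ringChar_residueField_prime : (ringChar 𝓀[K]).Prime := CharP.char_is_prime 𝓀[K] (ringChar 𝓀[K])

/-- `|n| = 1` for a natural number `n` prime to the residue characteristic. [cite: Serre1979, Ch. II §3] -/
theorem normAbs_natCast_eq_one_of_not_dvd {n : ℕ} (hn : ¬ ringChar 𝓀[K] ∣ n) : normAbs K (n : K) = 1 := by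
  have hle : normAbs K (n : K) ≤ 1 := normAbs_le_one_iff.2 (by exact_mod_cast (n : 𝒪[K]).2)
  refine le_antisymm hle (not_lt.1 fun hlt => hn ?_)
  have hmem : ((n : 𝒪[K]) : 𝒪[K]) ∈ 𝓂[K] := normAbs_lt_one_iff_mem_maximalIdeal.1 (by exact_mod_cast hlt)
  have h0 : (n : 𝓀[K]) = 0 := by rw [← map_natCast (IsLocalRing.residue 𝒪[K]), IsLocalRing.residue_eq_zero_iff]; exact hmem
  exact (CharP.cast_eq_zero_iff 𝓀[K] (ringChar 𝓀[K]) n).1 h0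

/-- `|p| < 1` for the residue characteristic `p`. [cite: Serre1979, Ch. II §3] -/
theorem normAbs_ringChar_lt_one : normAbs K (ringChar 𝓀[K] : K) < 1 := by
  have hmem : ((ringChar 𝓀[K] : 𝒪[K]) : 𝒪[K]) ∈ 𝓂[K] := by
    rw [← IsLocalRing.residue_eq_zero_iff, map_natCast]; exact CharP.cast_eq_zero 𝓀[K] (ringChar 𝓀[K])
  exact_mod_cast normAbs_lt_one_iff_mem_maximalIdeal.2 hmem

/-- `0 < |p|` in characteristic zero. [folklore] -/
theorem normAbs_ringChar_pos [CharZero K] : 0 < normAbs K (ringChar 𝓀[K] : K) :=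
  pos_iff_ne_zero.2 ((map_ne_zero (normAbs K)).2 (Nat.cast_ne_zero.2 ringChar_residueField_prime.ne_zero))

/-- `|p| ≤ |2|`: either `p = 2`, or `2` is a unit. [folklore] -/
theorem normAbs_ringChar_le_normAbs_two : normAbs K (ringChar 𝓀[K] : K) ≤ normAbs K (2 : K) := by
  by_cases h2 : ringChar 𝓀[K] ∣ 2
  · rw [(Nat.prime_dvd_prime_iff_eq ringChar_residueField_prime Nat.prime_two).1 h2, Nat.cast_ofNat]
  · have h := normAbs_natCast_eq_one_of_not_dvd (K := K) h2
    rw [Nat.cast_ofNat] at h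
    exact h ▸ normAbs_ringChar_lt_one.le

/-- `|n| ≥ |p|^(k−1)` for `0 < n < p^k`: write `n = p^e n'` with `p ∤ n'`, `e < k`. [cite: Serre1979, Ch. II §3] -/
theorem pow_le_normAbs_natCast_of_lt_pow {n k : ℕ} (hn0 : n ≠ 0) (hnk : n < ringChar 𝓀[K] ^ k) :
    normAbs K (ringChar 𝓀[K] : K) ^ (k - 1) ≤ normAbs K (n : K) := by
  have hp := ringChar_residueField_prime (K := K)
  obtain ⟨e, n', hn', rfl⟩ := Nat.exists_eq_pow_mul_and_not_dvd hn0 (ringChar 𝓀[K]) hp.one_lt.ne'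
  have hn'0 : n' ≠ 0 := fun h => hn' (h ▸ dvd_zero _)
  have hek : e ≤ k - 1 := by
    have hlt : ringChar 𝓀[K] ^ e < ringChar 𝓀[K] ^ k := lt_of_le_of_lt (Nat.le_mul_of_pos_right _ (Nat.pos_of_ne_zero hn'0)) hnk
    have := (Nat.pow_lt_pow_iff_right hp.one_lt).1 hlt
    omega
  rw [Nat.cast_mul, Nat.cast_pow, map_mul, map_pow, normAbs_natCast_eq_one_of_not_dvd hn', mul_one]
  exact pow_le_pow_of_le_one zero_le normAbs_ringChar_lt_one.le hek

/-- The test elements `1 + p² m` have absolute value `1`. [folklore] -/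
theorem normAbs_one_add_sq_mul_eq_one [CharZero K] (m : ℕ) : normAbs K (1 + (ringChar 𝓀[K] : K) ^ 2 * m) = 1 := by
  have hm : normAbs K (m : K) ≤ 1 := normAbs_le_one_iff.2 (by exact_mod_cast (m : 𝒪[K]).2)
  have hlt : normAbs K ((ringChar 𝓀[K] : K) ^ 2 * m) < normAbs K (1 : K) := by
    rw [map_mul, map_pow, map_one]
    calc normAbs K (ringChar 𝓀[K] : K) ^ 2 * normAbs K (m : K) ≤ normAbs K (ringChar 𝓀[K] : K) ^ 2 * 1 := by gcongr
      _ < 1 := by rw [mul_one]; exact pow_lt_one₀ zero_le normAbs_ringChar_lt_one two_ne_zero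
  rw [normAbs_add_eq_of_lt hlt, map_one]

/-- The test elements `1 + p² m` are non-zero. [folklore] -/
theorem one_add_sq_mul_ne_zero [CharZero K] (m : ℕ) : (1 + (ringChar 𝓀[K] : K) ^ 2 * m) ≠ 0 := fun h => by
  have h1 := normAbs_one_add_sq_mul_eq_one (K := K) m; rw [h, map_zero] at h1; exact zero_ne_one h1

/-- The test units `u_m := 1 + p² m` lie in `𝒪ˣ`. [folklore] -/
theorem valuation_testUnit_eq_one [CharZero K] (m : ℕ) :
    valuation K ((Units.mk0 (1 + (ringChar 𝓀[K] : K) ^ 2 * m) (one_add_sq_mul_ne_zero m) : Kˣ) : K) = 1 := by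
  rw [Units.val_mk0]; exact normAbs_eq_one_iff_valuation_eq_one.1 (normAbs_one_add_sq_mul_eq_one m)

/-- `|2 + p² s| = |2|` (`|p² s| ≤ |p|² < |p| ≤ |2|`). [folklore] -/
theorem normAbs_two_add_sq_mul [CharZero K] (s : ℕ) : normAbs K (2 + (ringChar 𝓀[K] : K) ^ 2 * s) = normAbs K (2 : K) := by
  have hs : normAbs K (s : K) ≤ 1 := normAbs_le_one_iff.2 (by exact_mod_cast (s : 𝒪[K]).2)
  apply normAbs_add_eq_of_lt
  rw [map_mul, map_pow]
  calc normAbs K (ringChar 𝓀[K] : K) ^ 2 * normAbs K (s : K) ≤ normAbs K (ringChar 𝓀[K] : K) ^ 2 * 1 := by gcongr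
    _ < normAbs K (ringChar 𝓀[K] : K) := by
        rw [mul_one]; exact pow_lt_self_of_lt_one₀ normAbs_ringChar_pos normAbs_ringChar_lt_one one_lt_two
    _ ≤ normAbs K (2 : K) := normAbs_ringChar_le_normAbs_two

/-- **SEPARATION OF THE TEST UNITS**: for `m' < m < p^k` and `e ∈ {1, 2}` (the additive map and the norm map send `u_m` to `u_m^e`),
`|u_m^e − u_{m'}^e| ≥ |2|·|p|^{k+1}`. [cite: Serre1979, Ch. IV §2] -/
theorem sep_testUnit [CharZero K] {k m m' : ℕ} (hm'm : m' < m) (hmk : m < ringChar 𝓀[K] ^ k) {e : ℕ} (he : e = 1 ∨ e = 2) :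
    normAbs K (2 : K) * normAbs K (ringChar 𝓀[K] : K) ^ (k + 1) ≤
      normAbs K ((1 + (ringChar 𝓀[K] : K) ^ 2 * m) ^ e - (1 + (ringChar 𝓀[K] : K) ^ 2 * m') ^ e) := by
  set P : K := (ringChar 𝓀[K] : K) with hP
  have hd : normAbs K P ^ (k - 1) ≤ normAbs K ((m - m' : ℕ) : K) :=
    pow_le_normAbs_natCast_of_lt_pow (Nat.sub_ne_zero_of_lt hm'm) (lt_of_le_of_lt (Nat.sub_le m m') hmk)
  have hcast : ((m - m' : ℕ) : K) = (m : K) - (m' : K) := Nat.cast_sub hm'm.le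
  have h2le : normAbs K (2 : K) ≤ 1 := normAbs_le_one_iff.2 (by exact_mod_cast (2 : 𝒪[K]).2)
  have hk1 : 1 ≤ k := Nat.one_le_iff_ne_zero.2 (by rintro rfl; rw [pow_zero] at hmk; omega)
  have hpow : normAbs K P ^ (k + 1) = normAbs K P ^ 2 * normAbs K P ^ (k - 1) := by rw [← pow_add]; congr 1; omega
  -- the common factor `p² (m − m')`
  have hcore : normAbs K (2 : K) * normAbs K P ^ (k + 1) ≤ normAbs K (2 : K) * normAbs K (P ^ 2 * ((m : K) - m')) := by
    rw [map_mul, map_pow, ← hcast, hpow]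
    gcongr
  rcases he with rfl | rfl
  · -- `e = 1`: the difference is `p² (m − m')`, and `|2| ≤ 1`
    have h : (1 + P ^ 2 * m) ^ 1 - (1 + P ^ 2 * m') ^ 1 = P ^ 2 * ((m : K) - m') := by ring
    rw [h]
    calc normAbs K (2 : K) * normAbs K P ^ (k + 1) ≤ normAbs K (2 : K) * normAbs K (P ^ 2 * ((m : K) - m')) := hcore
      _ ≤ 1 * normAbs K (P ^ 2 * ((m : K) - m')) := by gcongr
      _ = normAbs K (P ^ 2 * ((m : K) - m')) := one_mul _
  · -- `e = 2`: the difference is `p² (m − m') (2 + p² (m + m'))`, and `|2 + p²(m + m')| = |2|`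
    have h : (1 + P ^ 2 * m) ^ 2 - (1 + P ^ 2 * m') ^ 2 = P ^ 2 * ((m : K) - m') * (2 + P ^ 2 * ((m + m' : ℕ) : K)) := by
      push_cast; ring
    rw [h, map_mul, normAbs_two_add_sq_mul, mul_comm (normAbs K (P ^ 2 * _))]
    exact hcore

/-! ## §4  `p^k · μ'(E) ≤ μ'(𝒪ˣ)` for `r < |2|·|p|^{k+1}`, for both events -/

section Count

variable [CharZero K] [MeasurableSpace Kˣ] [BorelSpace Kˣ] (μ' : Measure Kˣ) [μ'.IsMulLeftInvariant]

/-- **The count for a general `φ`** sending the test unit `u_m` to `(1 + p² m)^e`, `e ∈ {1, 2}`: `p^k · μ'(E_φ(c, r)) ≤ μ'(𝒪ˣ)` for `r < |2|·|p|^{k+1}`.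
[cite: Serre1979, Ch. IV §2] -/
theorem pow_mul_measure_event_le (φ : Kˣ → K) (hφ : ∀ a b, φ (a * b) = φ a * φ b)
    (hφ1 : ∀ a : Kˣ, valuation K (a : K) = 1 → normAbs K (φ a) = 1) {e : ℕ} (he : e = 1 ∨ e = 2)
    (hφu : ∀ m : ℕ, φ (Units.mk0 (1 + (ringChar 𝓀[K] : K) ^ 2 * m) (one_add_sq_mul_ne_zero m)) = (1 + (ringChar 𝓀[K] : K) ^ 2 * m) ^ e)
    (c : K) {r : ℝ≥0} (hEm : MeasurableSet {a : Kˣ | valuation K (a : K) = 1 ∧ normAbs K (φ a - c) ≤ r}) {k : ℕ}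
    (hr : r < normAbs K (2 : K) * normAbs K (ringChar 𝓀[K] : K) ^ (k + 1)) :
    ((ringChar 𝓀[K] : ℝ≥0∞) ^ k) * μ' {a : Kˣ | valuation K (a : K) = 1 ∧ normAbs K (φ a - c) ≤ r} ≤
      μ' {a : Kˣ | valuation K (a : K) = 1} := by
  have h := card_mul_measure_event_le μ' φ hφ hφ1 c r hEm (Finset.range (ringChar 𝓀[K] ^ k))
    (fun m => Units.mk0 (1 + (ringChar 𝓀[K] : K) ^ 2 * m) (one_add_sq_mul_ne_zero m)) (fun m _ => valuation_testUnit_eq_one m) ?_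
  · rwa [Finset.card_range, Nat.cast_pow] at h
  · intro i hi j hj hij
    rw [Finset.mem_range] at hi hj
    rw [hφu, hφu]
    rcases lt_or_gt_of_ne hij with hlt | hlt
    · rw [← normAbs_neg, neg_sub]
      exact hr.trans_le (sep_testUnit hlt hj he)
    · exact hr.trans_le (sep_testUnit hlt hi he)

/-- **THE COUNT, ADDITIVE EVENT**: `p^k · μ'{a ∈ 𝒪ˣ : |a − c| ≤ r} ≤ μ'(𝒪ˣ)` for `r < |2|·|p|^{k+1}`. [cite: Serre1979, Ch. IV §2] -/
theorem pow_mul_measure_addEvent_le (c : K) {r : ℝ≥0} {k : ℕ} (hr : r < normAbs K (2 : K) * normAbs K (ringChar 𝓀[K] : K) ^ (k + 1)) :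
    ((ringChar 𝓀[K] : ℝ≥0∞) ^ k) * μ' {a : Kˣ | valuation K (a : K) = 1 ∧ normAbs K ((a : K) - c) ≤ r} ≤
      μ' {a : Kˣ | valuation K (a : K) = 1} :=
  pow_mul_measure_event_le μ' (fun a : Kˣ => (a : K)) (fun a b => Units.val_mul a b)
    (fun _ ha => normAbs_eq_one_iff_valuation_eq_one.2 ha) (e := 1) (Or.inl rfl) (fun m => by rw [Units.val_mk0, pow_one]) c
    (measurableSet_sphere_inter_normAbs_le (Units.continuous_val.sub continuous_const) r) hr

/-- **THE COUNT, NORM EVENT**: `p^k · μ'{a ∈ 𝒪ˣ : |a σ(a) − c| ≤ r} ≤ μ'(𝒪ˣ)` for `r < |2|·|p|^{k+1}` (`σ` fixes the rational test units, so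
`φ(u_m) = u_m²`). [cite: Serre1979, Ch. IV §2] -/
theorem pow_mul_measure_normEvent_le (σ : K →+* K) (hσn : ∀ x, normAbs K (σ x) = normAbs K x) (c : K) {r : ℝ≥0} {k : ℕ}
    (hr : r < normAbs K (2 : K) * normAbs K (ringChar 𝓀[K] : K) ^ (k + 1)) :
    ((ringChar 𝓀[K] : ℝ≥0∞) ^ k) * μ' {a : Kˣ | valuation K (a : K) = 1 ∧ normAbs K ((a : K) * σ (a : K) - c) ≤ r} ≤
      μ' {a : Kˣ | valuation K (a : K) = 1} :=
  pow_mul_measure_event_le μ' (fun a : Kˣ => (a : K) * σ (a : K)) (fun a b => by rw [Units.val_mul, map_mul]; ring)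
    (fun a ha => by rw [map_mul, hσn, normAbs_eq_one_iff_valuation_eq_one.2 ha, one_mul])
    (e := 2) (Or.inr rfl) (fun m => by rw [Units.val_mk0]; simp only [map_add, map_one, map_mul, map_pow, map_natCast]; ring) c
    (measurableSet_sphere_inter_normAbs_le
      ((Units.continuous_val.mul ((continuous_of_normAbs_eq σ hσn).comp Units.continuous_val)).sub continuous_const) r) hr

end Count

/-! ## §5  The exponent `κ = log p ∕ log |p|⁻¹`, the constant `C = p² (|2||p|)^{−κ}`, and the head -/

/-- **The analytic step.**  Let `2 ≤ p`, `0 < t < 1`, `0 < s`, `κ := log p ∕ (−log t)` and suppose `A ≤ B < ∞` with `p^k · A ≤ B` whenever `r < s·t^{k+1}`.  Then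
`A ≤ p²·((s·t)^κ)⁻¹ · r^κ · B`: for `r ≥ s t` the factor is `≥ p² ≥ 1`; for `r = 0` every `k` applies and `A = 0`; otherwise take `k` maximal, so that
`s t^{k+2} ≤ r` and `p^{−k} ≤ p·p^{−k} = p² (s^κ p⁻¹)⁻¹ · s^κ (t^κ)^{k+2} ≤ p² (s^κ t^κ)⁻¹ r^κ` (`t^κ = p⁻¹`). [folklore] -/
theorem le_const_mul_rpow_mul_of_count {p : ℕ} (hp : 2 ≤ p) {t s : ℝ≥0} (ht0 : 0 < t) (ht1 : t < 1) (hs0 : 0 < s)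
    {A B : ℝ≥0∞} (hAB : A ≤ B) (hB : B ≠ ⊤) {r : ℝ≥0} (hcount : ∀ k : ℕ, r < s * t ^ (k + 1) → (p : ℝ≥0∞) ^ k * A ≤ B) :
    A ≤ (((p : ℝ≥0) ^ 2 * ((s * t) ^ (Real.log p / -Real.log t))⁻¹ : ℝ≥0) : ℝ≥0∞) *
      (r : ℝ≥0∞) ^ (Real.log p / -Real.log t) * B := by
  set κ : ℝ := Real.log p / -Real.log t with hκ
  have hp0 : (0 : ℝ) < p := by exact_mod_cast (zero_lt_two.trans_le hp)
  have hlogp : 0 < Real.log p := Real.log_pos (by exact_mod_cast (Nat.lt_of_lt_of_le one_lt_two hp))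
  have hlogt : Real.log t < 0 := Real.log_neg (by exact_mod_cast ht0) (by exact_mod_cast ht1)
  have hκ0 : 0 < κ := div_pos hlogp (neg_pos.2 hlogt)
  -- `t ^ κ = p⁻¹`
  have htκ : (t : ℝ) ^ κ = (p : ℝ)⁻¹ := by
    rw [Real.rpow_def_of_pos (by exact_mod_cast ht0), hκ]
    have hlogt0 : Real.log t ≠ 0 := hlogt.ne
    have : Real.log t * (Real.log p / -Real.log t) = -Real.log p := by field_simp
    rw [this, Real.exp_neg, Real.exp_log hp0]
  have hst0 : 0 < s * t := mul_pos hs0 ht0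
  have hfac : ((((p : ℝ≥0) ^ 2 * ((s * t) ^ κ)⁻¹ : ℝ≥0) : ℝ≥0∞) * (r : ℝ≥0∞) ^ κ) =
      (((p : ℝ≥0) ^ 2 * ((s * t) ^ κ)⁻¹ * r ^ κ : ℝ≥0) : ℝ≥0∞) := by
    rw [← ENNReal.coe_rpow_of_nonneg _ hκ0.le, ← ENNReal.coe_mul]
  rcases le_or_gt (s * t) r with hr | hr
  · -- large `r`: the factor is at least `p² ≥ 1`
    have h1 : (1 : ℝ≥0) ≤ (p : ℝ≥0) ^ 2 * ((s * t) ^ κ)⁻¹ * r ^ κ := by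
      have hmono : (s * t) ^ κ ≤ r ^ κ := NNReal.rpow_le_rpow hr hκ0.le
      have hpos : 0 < (s * t) ^ κ := NNReal.rpow_pos hst0
      calc (1 : ℝ≥0) ≤ (p : ℝ≥0) ^ 2 := by exact_mod_cast Nat.one_le_pow 2 p (zero_lt_two.trans_le hp)
        _ = (p : ℝ≥0) ^ 2 * ((s * t) ^ κ)⁻¹ * (s * t) ^ κ := by rw [mul_assoc, inv_mul_cancel₀ hpos.ne', mul_one]
        _ ≤ (p : ℝ≥0) ^ 2 * ((s * t) ^ κ)⁻¹ * r ^ κ := by gcongr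
    calc A ≤ B := hAB
      _ ≤ (((p : ℝ≥0) ^ 2 * ((s * t) ^ κ)⁻¹ * r ^ κ : ℝ≥0) : ℝ≥0∞) * B := le_mul_of_one_le_left zero_le (by exact_mod_cast h1)
      _ = _ := by rw [← hfac]
  rcases eq_or_ne r 0 with rfl | hr0
  · -- `r = 0`: every `k` applies, so `A = 0`
    have hA : A = 0 := by
      by_contra hA
      have hAt : A ≠ ⊤ := ne_top_of_le_ne_top hB hAB
      obtain ⟨k, hk⟩ := ENNReal.exists_nat_gt (ENNReal.div_lt_top hB hA).ne
      have hk' : B / A < (p : ℝ≥0∞) ^ k := by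
        refine hk.trans_le ?_
        calc (k : ℝ≥0∞) ≤ (2 : ℝ≥0∞) ^ k := by exact_mod_cast (Nat.lt_two_pow_self).le
          _ ≤ (p : ℝ≥0∞) ^ k := by gcongr; exact_mod_cast hp
      have hlt : B < (p : ℝ≥0∞) ^ k * A := (ENNReal.div_lt_iff (Or.inl hA) (Or.inl hAt)).1 hk'
      exact absurd (hcount k (by positivity)) (not_le.2 hlt)
    exact hA ▸ zero_le
  -- `0 < r < s t`: pick `k` maximal with `r < s t^{k+1}`
  have hex : ∃ n : ℕ, s * t ^ n ≤ r := by
    obtain ⟨n, hn⟩ := exists_pow_lt_of_lt_one (div_pos (pos_iff_ne_zero.2 hr0) hs0) ht1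
    exact ⟨n, by rw [mul_comm]; exact (le_div_iff₀ hs0).1 hn.le⟩
  classical
  have hn₀spec : s * t ^ Nat.find hex ≤ r := Nat.find_spec hex
  have hn₀min : ∀ n, n < Nat.find hex → r < s * t ^ n := fun n hn => not_le.1 (Nat.find_min hex hn)
  have hn₀2 : 2 ≤ Nat.find hex := by
    by_contra h
    have hle : s * t ^ 1 ≤ s * t ^ Nat.find hex := mul_le_mul_of_nonneg_left (pow_le_pow_of_le_one zero_le ht1.le (by omega)) zero_le
    rw [pow_one] at hle
    exact absurd (hle.trans hn₀spec) (not_le.2 hr)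
  obtain ⟨k, hk⟩ : ∃ k, Nat.find hex = k + 2 := ⟨Nat.find hex - 2, by omega⟩
  have hcnt := hcount k (hn₀min (k + 1) (by omega))
  have hpk0 : (p : ℝ≥0∞) ^ k ≠ 0 := pow_ne_zero _ (by exact_mod_cast (zero_lt_two.trans_le hp).ne')
  have hA : A ≤ ((p : ℝ≥0∞) ^ k)⁻¹ * B := (ENNReal.mul_le_iff_le_inv hpk0 (ENNReal.pow_ne_top ENNReal.coe_ne_top)).1 hcnt
  -- the real-number inequality `p^{-k} ≤ p² (s t)^{-κ} r^κ`
  have hreal : ((p : ℝ≥0) ^ k)⁻¹ ≤ (p : ℝ≥0) ^ 2 * ((s * t) ^ κ)⁻¹ * r ^ κ := by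
    rw [hk] at hn₀spec
    have hmono : (s * t ^ (k + 2)) ^ κ ≤ r ^ κ := NNReal.rpow_le_rpow hn₀spec hκ0.le
    have hs0' : (0 : ℝ) < s := by exact_mod_cast hs0
    have ht0' : (0 : ℝ) < t := by exact_mod_cast ht0
    have hp1 : (1 : ℝ) ≤ p := by exact_mod_cast (one_lt_two.trans_le hp).le
    have hmono' : ((s : ℝ) * (t : ℝ) ^ (k + 2)) ^ κ ≤ (r : ℝ) ^ κ := by exact_mod_cast hmono
    rw [Real.mul_rpow hs0'.le (pow_nonneg ht0'.le _), ← Real.rpow_pow_comm ht0'.le, htκ, inv_pow] at hmono'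
    rw [← NNReal.coe_le_coe]
    push_cast
    rw [Real.mul_rpow hs0'.le ht0'.le, htκ]
    have hsκ0 : (s : ℝ) ^ κ ≠ 0 := (Real.rpow_pos_of_pos hs0' κ).ne'
    have hp0' : (p : ℝ) ≠ 0 := hp0.ne'
    calc ((p : ℝ) ^ k)⁻¹ ≤ (p : ℝ) * ((p : ℝ) ^ k)⁻¹ := le_mul_of_one_le_left (by positivity) hp1
      _ = (p : ℝ) ^ 2 * ((s : ℝ) ^ κ * (p : ℝ)⁻¹)⁻¹ * ((s : ℝ) ^ κ * ((p : ℝ) ^ (k + 2))⁻¹) := by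
          field_simp
          ring
      _ ≤ (p : ℝ) ^ 2 * ((s : ℝ) ^ κ * (p : ℝ)⁻¹)⁻¹ * (r : ℝ) ^ κ := by gcongr
  calc A ≤ ((p : ℝ≥0∞) ^ k)⁻¹ * B := hA
    _ ≤ (((p : ℝ≥0) ^ 2 * ((s * t) ^ κ)⁻¹ * r ^ κ : ℝ≥0) : ℝ≥0∞) * B := by
        gcongr
        rw [← ENNReal.coe_natCast, ← ENNReal.coe_pow, ← ENNReal.coe_inv (pow_ne_zero _ (by exact_mod_cast (zero_lt_two.trans_le hp).ne'))]
        exact_mod_cast hreal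
    _ = _ := by rw [← hfac]

/-- **(FC-D) THE DIGIT-COUNT FIBRE BOUNDS ON `𝒪_K^×`** (head frozen by K2E3-p20 (g4), consumed by (FC-5)).  For a non-archimedean local field `K` of
characteristic `0`, an involutive isometric `σ : K →+* K` and a Haar measure `μ'` on `Kˣ` there are `κ > 0` and `C < ∞` with, for all `r ≤ 1` and `|x| = 1`,
`μ'{a ∈ 𝒪ˣ : |a x − y| ≤ r} ≤ C r^κ μ'(𝒪ˣ)` and `μ'{a ∈ 𝒪ˣ : |a σ(a) x − y| ≤ r} ≤ C r^κ μ'(𝒪ˣ)`.  Proof: both events are `E_φ(y x⁻¹, r)` (§3), and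
`p^k μ'(E_φ) ≤ μ'(𝒪ˣ)` for `r < |2||p|^{k+1}` (§4) feeds §5 with `t = |p|`, `s = |2|`: `κ = log p ∕ log |p|⁻¹`, `C = p² (|2||p|)^{−κ}`.  (The involution
hypothesis `hσ` and `r ≤ 1` belong to the frozen interface and are not needed.) [cite: Serre1979, Ch. IV §2] [cite: Folland1995, §2.2] -/
theorem unitsDigitFibre {K : Type*} [Field K] [ValuativeRel K] [TopologicalSpace K] [IsNonarchimedeanLocalField K] [CharZero K] (σ : K →+* K) (hσ : ∀ x, σ (σ x) = x) (hσn : ∀ x, normAbs K (σ x) = normAbs K x) [MeasurableSpace Kˣ] [BorelSpace Kˣ] (μ' : Measure Kˣ) [μ'.IsHaarMeasure] : ∃ κ : ℝ, 0 < κ ∧ ∃ C : ℝ≥0∞, C ≠ ⊤ ∧ ∀ r : ℝ≥0, r ≤ 1 → ∀ x y : K, normAbs K x = 1 → μ' {a : Kˣ | valuation K ↑a = 1 ∧ normAbs K (↑a * x - y) ≤ r} ≤ C * (r : ℝ≥0∞) ^ κ * μ' {a : Kˣ | valuation K ↑a = 1} ∧ μ' {a : Kˣ | valuation K ↑a = 1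 ∧ normAbs K (↑a * σ ↑a * x - y) ≤ r} ≤ C * (r : ℝ≥0∞) ^ κ * μ' {a : Kˣ | valuation K ↑a = 1} := by
  have _hσ := hσ
  have hpp : (ringChar 𝓀[K]).Prime := ringChar_residueField_prime
  have ht0 : 0 < normAbs K (ringChar 𝓀[K] : K) := normAbs_ringChar_pos
  have ht1 : normAbs K (ringChar 𝓀[K] : K) < 1 := normAbs_ringChar_lt_one
  have hs0 : 0 < normAbs K (2 : K) := ht0.trans_le normAbs_ringChar_le_normAbs_two
  have hlogp : 0 < Real.log (ringChar 𝓀[K]) := Real.log_pos (by exact_mod_cast hpp.one_lt)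
  have hlogt : Real.log (normAbs K (ringChar 𝓀[K] : K)) < 0 := Real.log_neg (by exact_mod_cast ht0) (by exact_mod_cast ht1)
  have hS : μ' {a : Kˣ | valuation K (a : K) = 1} ≠ ⊤ := ((isCompact_units_valuation_eq_one (F := K)).measure_lt_top (μ := μ')).ne
  refine ⟨Real.log (ringChar 𝓀[K]) / -Real.log (normAbs K (ringChar 𝓀[K] : K)), div_pos hlogp (neg_pos.2 hlogt),
    (((ringChar 𝓀[K] : ℝ≥0) ^ 2 * ((normAbs K (2 : K) * normAbs K (ringChar 𝓀[K] : K)) ^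
      (Real.log (ringChar 𝓀[K]) / -Real.log (normAbs K (ringChar 𝓀[K] : K))))⁻¹ : ℝ≥0) : ℝ≥0∞),
    ENNReal.coe_ne_top, fun r _ x y hx => ⟨?_, ?_⟩⟩
  · -- the additive event `= E_val(y x⁻¹, r)`
    have hE : {a : Kˣ | valuation K (a : K) = 1 ∧ normAbs K ((a : K) * x - y) ≤ r} =
        {a : Kˣ | valuation K (a : K) = 1 ∧ normAbs K ((a : K) - y * x⁻¹) ≤ r} := by
      ext a; rw [Set.mem_setOf_eq, Set.mem_setOf_eq, normAbs_mul_sub_eq_of_normAbs_eq_one hx]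
    rw [hE]
    exact le_const_mul_rpow_mul_of_count hpp.two_le ht0 ht1 hs0 (measure_mono fun a ha => ha.1) hS
      fun k hk => pow_mul_measure_addEvent_le μ' (y * x⁻¹) hk
  · -- the norm event `= E_N(y x⁻¹, r)`
    have hE : {a : Kˣ | valuation K (a : K) = 1 ∧ normAbs K ((a : K) * σ (a : K) * x - y) ≤ r} =
        {a : Kˣ | valuation K (a : K) = 1 ∧ normAbs K ((a : K) * σ (a : K) - y * x⁻¹) ≤ r} := by
      ext a; rw [Set.mem_setOf_eq, Set.mem_setOf_eq, normAbs_mul_sub_eq_of_normAbs_eq_one hx]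
    rw [hE]
    exact le_const_mul_rpow_mul_of_count hpp.two_le ht0 ht1 hs0 (measure_mono fun a ha => ha.1) hS
      fun k hk => pow_mul_measure_normEvent_le μ' σ hσn (y * x⁻¹) hk

end Summit.HodgeConjecture.HodgeConjecture.Cruxes.H413.K2E3UnitsDigitFibre

end
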